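import Summits.Ventures.CertifiedManyBodySolver.Observables.TIGroundStatePairLROCeilingHolds
import Literature.MathematicalPhysics.QuantumLattice.PairStructureFactorWindowTightness
import Literature.MathematicalPhysics.QuantumLattice.DWaveSourceEnergyDensityEnsembles
import Literature.MathematicalPhysics.QuantumLattice.DWaveSourceNNNHoppingOrderParameter
import Literature.MathematicalPhysics.QuantumLattice.InfVolFermionStateCompactness
import Literature.MathematicalPhysics.QuantumLattice.SourcedTorusGroundStatePairLROFloor

/-!
# Koma–Tasaki's Theorem 7.3 on the TORUS at every `t'`, by the infinite-volume detour:
# the pair long-range order of torus ground states is asymptotically at most `(m⋆)²`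

Cell `hubbard-cq` (venture `CertifiedManyBodySolver`; seat hubbard-cq-p4, KT dictionary (44), TORUS HALF). The
tree's torus-side Koma–Tasaki ceiling `le_dWaveOrderParameter_of_pairLRO[_lowLying]`
(`Literature/…/DWaveSourceKomaTasaki{Field,PairLRO,LowLying}.lean`, hubbard-cq-p4 g0) is the `t' = 0`
finite-volume inequality with explicit constants, built on the `U(1)`-overlap system `dWaveKTSystem` of the
nearest-neighbour Hubbard torus. Here the SAME conclusion — asymptotically — is obtained for EVERY `t'`, for
grand-canonical ground states at every field `h ≥ 0` and for the summit's canonical sector ground states, with NO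
commutator bookkeeping, by passing through the infinite volume:

  `s_L(ψ_L) ≤ b_{L,n}(ψ_L)` (Fejér, hubbard-cq-p6 `torusDiagonal_le_boxAvgPairCorr`)
  `b_{L_j,n}(ψ_{L_j}) → boxLRO_n(ω)` along every torus limit `ω` (hubbard-cq-p6 `IsTorusLimitOf.tendsto_boxAvgPairCorr`)
  torus limits of ground-state vectors are translation-invariant ground states (hubbard-cq-obsth-2
  `IsTorusLimitOf.isMeanEnergyMinimiser_sourced`; sector version hubbard-cq-p4
  `IsTorusLimitOf.symmetric_groundState_of_sectorGroundStates`)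
  `limsup_n boxLRO_n(ω) ≤ (∂⁺E(h)/2)²` for every translation-invariant ground state (the transplant lens's chain
  (α)–(η), hubbard-cq-p1/p3/p4/p5, `tiGroundStatePairLROCeiling_holds`)
  weak-⋆ compactness of the averaged states (`exists_isTorusLimitOf_subseq`) to run the contradiction.

* `eventually_torusDiagonal_le_of_torusLimitCeiling` — the ABSTRACT PASSAGE (any form factor `g`): if every
  torus limit `ω` of every subsequence of the unit vectors `ψ_{L_j}` has `limsup_n boxavg_n(ω) ≤ c`, then
  `∀ ε > 0`, eventually `s_{L_j}(ψ_{L_j}) ≤ c + ε`.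
* `eventually_torusDiagonal_le_of_groundStates` — **KT93 Thm 7.3, grand-canonical, every `t'`, every field
  `h ≥ 0`**: for unit ground-state vectors `ψ_{L_j}` of `A_{L_j}(t',U,μ,h) = dWaveSourceTorusTT' (Ls j) t' U μ h`,
  `∀ ε > 0`, eventually `s_{L_j} ≤ (∂⁺E(h)/2)² + ε`; at `h = 0` the ceiling is `(m⋆)²`,
  `m⋆ = dWaveOrderParameterTT' t' U μ` (`eventually_torusDiagonal_le_sq_dWaveOrderParameterTT'_add`); hence
  **pair LRO ⇒ response**: `(∃ᶠ j, s ≤ s_{L_j}) → √s ≤ m⋆` (`sqrt_le_dWaveOrderParameterTT'_of_frequently_le`)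
  and `HasDWaveOrderTT'` from any positive asymptotic torus pair LRO (`hasDWaveOrderTT'_of_frequently_le`).
* `eventually_torusDiagonal_le_of_sectorGroundStates` — **the summit's class**: for unit ground states of
  `hubbardTorusTT' (Ls j) 1 t' U` in the sectors `(rectN n (Ls j), S^z = 0)` (`U ≥ 0`, `0 < n < 2`): if
  `m⋆(t',U,μ)² ≤ c` at every chemical potential `μ` supporting a translation-invariant ground state of density
  `n`, then `∀ ε > 0`, eventually `s_{L_j} ≤ c + ε`; in particular (`c = 0`) NO quasi-average `d`-wave order at
  any supporting `μ` ⇒ the torus pair LRO of the sector ground states tends to `0`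
  (`tendsto_torusDiagonal_zero_of_sectorGroundStates`).

* (Band) at `h > 0`: `eventually_torusDiagonal_mem_Icc_of_groundStates` — eventually
  `(∂⁻E(h)/2)² − ε ≤ s_{L_j} ≤ (∂⁺E(h)/2)² + ε` (floor = hubbard-cq-p4's Literature
  `SourcedTorusGroundStatePairLROFloor`); `tendsto_torusDiagonal_of_groundStates_of_hasDerivAt` — off the kinks
  `s_{L_j} → (E'(h)/2)²` (clustering on the torus) and `tendsto_torusDiagonal_sub_sq_re_expect_div_of_hasDerivAt`
  (the torus pair LRO is asymptotically exhausted by the one-point amplitude).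

* (Sharp, modulo `[U] ∧ [BN7]`) `tendsto_torusDiagonal_sq_dWaveOrderParameterTT'_of_unique_symmetric_of_tight`: with p6's
  floor (F5) below and the ceiling above, `s_{L_j} → (m⋆)²` along torus-limit GS sequences — the SHARP torus identity
  under the two physics inputs of census (44)/(47); `exists_subseq_…` (subsequence form for any GS sequence).

`s_L(ψ) = torusDiagonal dWaveFormFactor L ψ = L⁻⁴ Re⟨ψ, Δ_d†Δ_d ψ⟩` (`pairStructureFactor_zero`) is the summit's
pair-LRO functional. HONEST SCOPE / WHAT THIS IS NOT: these are CEILINGS on torus pair LRO by the RESPONSE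
`m⋆` (the known direction, Koma–Tasaki 1993 Thm 7.3; new here: `t'`-generic, asymptotic, GC and sector, no
overlap system); they never FLOOR anything; the converse on the torus is [U] ∧ [BN7] (census (24)/(44)/(47));
no CQ bit; not a superconductivity verdict. Everything PROVED; no definition, no named fact; zero compute.

References: T. Koma, H. Tasaki, Commun. Math. Phys. 158 (1993) 191, Theorem 7.3 [cite: KomaTasaki1993, Theorem 7.3];
T. Koma, H. Tasaki, J. Stat. Phys. 76 (1994) 745, §1 [cite: KomaTasaki1994, §1]; O. Bratteli, D. W. Robinson,
OAQSM 1 (1987), Thm. 2.3.15 and §4.3.1 [cite: BratteliRobinsonI1987, §4.3.1].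
-/

noncomputable section

namespace Summit.Ventures.CertifiedManyBodySolver.Observables.TorusPairLROCeiling

open Matrix Finset Filter Topology Set Literature.MathematicalPhysics.QuantumLattice
open Literature.Probability.LatticeModels HubbardWave0 ThermodynamicLimit
open Summit.Ventures.CertifiedManyBodySolver.Observables.SourcedTorusAHM
open scoped ComplexOrder

variable {ψ : ∀ L, Fock (Orb (FermionTorus 2 L))} {Ls : ℕ → ℕ}

/-! ### The abstract passage: ceilings on the box LRO of all torus limits bound the torus diagonal -/

/-- **Infinite-volume ceilings come down to the torus**: if every torus limit `ω` of every subsequence of the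
unit torus vectors `ψ_{L_j}` satisfies `∀ δ > 0, ∀ᶠ n, boxavg_n(ω) ≤ c + δ`
(`boxavg_n(ω) = Re n⁻⁴ Σ_{x,y∈[0,n)²} ω(P_x⋆P_y)`, form factor `g` on `{0} ∪ unitSteps`), then for every `ε > 0`
eventually `s_{L_j}(ψ_{L_j}) ≤ c + ε`. (Otherwise a subsequence has `s > c + ε`; a further subsequence has a torus
limit `ω`; pick `n` with `boxavg_n(ω) ≤ c + ε/2`; `s_{L_j} ≤ b_{L_j,n} → boxavg_n(ω)` — contradiction.)
[cite: BratteliRobinsonI1987, §4.3.1] -/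
theorem eventually_torusDiagonal_le_of_torusLimitCeiling (g : Site 2 → ℝ) [∀ j, NeZero (Ls j)]
    (hLs : Tendsto Ls atTop atTop) (hunit : ∀ j, star (ψ (Ls j)) ⬝ᵥ ψ (Ls j) = 1) {c : ℝ}
    (hceil : ∀ φ : ℕ → ℕ, StrictMono φ → ∀ ω : InfVolFermionState 2, ω.IsTorusLimitOf ψ (Ls ∘ φ) →
      ∀ δ : ℝ, 0 < δ → ∀ᶠ n : ℕ in atTop,
        (((n : ℂ) ^ 4)⁻¹ * ∑ x ∈ halfOpenBox 2 n, ∑ y ∈ halfOpenBox 2 n,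
          ω.pairCorr (insert 0 unitSteps) g x y).re ≤ c + δ)
    {ε : ℝ} (hε : 0 < ε) :
    ∀ᶠ j in atTop, torusDiagonal g (Ls j) (ψ (Ls j)) ≤ c + ε := by
  by_contra hnot
  rw [Filter.not_eventually] at hnot
  obtain ⟨φ₀, hφ₀, hbig⟩ := Filter.extraction_of_frequently_atTop hnot
  have hLs₀ : Tendsto (Ls ∘ φ₀) atTop atTop := hLs.comp hφ₀.tendsto_atTop
  obtain ⟨φ₁, hφ₁, ω, hω⟩ :=
    InfVolFermionState.exists_isTorusLimitOf_subseq ψ hLs₀ (fun j => hunit (φ₀ j))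
  have hφ : StrictMono (φ₀ ∘ φ₁) := hφ₀.comp hφ₁
  have hε2 : 0 < ε / 2 := by linarith
  have hceil' := hceil (φ₀ ∘ φ₁) hφ ω hω (ε / 2) hε2
  obtain ⟨n, hn, hn1⟩ := (hceil'.and (eventually_ge_atTop 1)).exists
  haveI hNZ : ∀ k, NeZero (((Ls ∘ φ₀) ∘ φ₁) k) := fun k => inferInstanceAs (NeZero (Ls (φ₀ (φ₁ k))))
  have hLs₁ : Tendsto ((Ls ∘ φ₀) ∘ φ₁) atTop atTop := hLs₀.comp hφ₁.tendsto_atTop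
  have hconv := hω.tendsto_boxAvgPairCorr g hLs₁ n
  have hev : ∀ᶠ k in atTop, boxAvgPairCorr g (((Ls ∘ φ₀) ∘ φ₁) k) (ψ (((Ls ∘ φ₀) ∘ φ₁) k)) n ≤
      (((n : ℂ) ^ 4)⁻¹ * ∑ x ∈ halfOpenBox 2 n, ∑ y ∈ halfOpenBox 2 n,
        ω.pairCorr (insert 0 unitSteps) g x y).re + ε / 2 :=
    hconv.eventually (Iic_mem_nhds (by linarith))
  obtain ⟨k, hk⟩ := hev.exists
  have hF2 := torusDiagonal_le_boxAvgPairCorr g (((Ls ∘ φ₀) ∘ φ₁) k) (ψ (((Ls ∘ φ₀) ∘ φ₁) k)) (n := n) (by omega)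
  have hcontra := hbig (φ₁ k)
  simp only [Function.comp_apply] at hk hF2
  exact hcontra (by linarith)

/-! ### Grand-canonical ground states of the sourced `t–t'` torus, every field `h ≥ 0` -/

section GrandCanonical

variable [∀ j, NeZero (Ls j)] {t' U μ h : ℝ}

/-- **KOMA–TASAKI'S THEOREM 7.3 ON THE TORUS, every `t'`, every field `h ≥ 0`** (asymptotic form): for unit
ground-state vectors `ψ_{L_j}` of the pair-sourced grand-canonical tori `A_{L_j}(t',U,μ,h)` along `L_j → ∞`,
`∀ ε > 0`, eventually `L⁻⁴ Re⟨ψ, Δ_d†Δ_d ψ⟩ ≤ (∂⁺E(h)/2)² + ε`, `E = dWaveSourceEnergyDensityTT' t' U μ`.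
[cite: KomaTasaki1993, Theorem 7.3] -/
theorem eventually_torusDiagonal_le_of_groundStates (hLs : Tendsto Ls atTop atTop) (hh : 0 ≤ h)
    (hunit : ∀ j, star (ψ (Ls j)) ⬝ᵥ ψ (Ls j) = 1)
    (hgs : ∀ j, dWaveSourceTorusTT' (Ls j) t' U μ h *ᵥ ψ (Ls j) =
      (((dWaveSourceTorusTT' (Ls j) t' U μ h).groundEnergy : ℝ) : ℂ) • ψ (Ls j))
    {ε : ℝ} (hε : 0 < ε) :
    ∀ᶠ j in atTop, torusDiagonal dWaveFormFactor (Ls j) (ψ (Ls j)) ≤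
      (derivWithin (dWaveSourceEnergyDensityTT' t' U μ) (Ioi h) h / 2) ^ 2 + ε := by
  refine eventually_torusDiagonal_le_of_torusLimitCeiling dWaveFormFactor hLs hunit ?_ hε
  intro φ hφ ω hω δ hδ
  haveI : ∀ k, NeZero ((Ls ∘ φ) k) := fun k => inferInstanceAs (NeZero (Ls (φ k)))
  have hLs' : Tendsto (Ls ∘ φ) atTop atTop := hLs.comp hφ.tendsto_atTop
  have hmin : ω.IsMeanEnergyMinimiser (hubbardTTPrimeSourcedInteraction 1 t' U μ dWaveFormFactor h) 1 :=
    hω.isMeanEnergyMinimiser_sourced hLs' (fun j => hunit (φ j)) t' U μ h (fun j => hgs (φ j))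
  exact tiGroundStatePairLROCeiling_holds t' U μ hh hmin δ hδ

/-- **At zero field the ceiling is `(m⋆)²`**: for unit ground-state vectors of the grand-canonical `t–t'` tori
`hubbardTorusTT' − μN` (`= dWaveSourceTorusTT' L t' U μ 0`), `∀ ε > 0`, eventually
`L⁻⁴ Re⟨ψ, Δ_d†Δ_d ψ⟩ ≤ (dWaveOrderParameterTT' t' U μ)² + ε`. [cite: KomaTasaki1993, Theorem 7.3] -/
theorem eventually_torusDiagonal_le_sq_dWaveOrderParameterTT'_add (hLs : Tendsto Ls atTop atTop)
    (hunit : ∀ j, star (ψ (Ls j)) ⬝ᵥ ψ (Ls j) = 1)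
    (hgs : ∀ j, dWaveSourceTorusTT' (Ls j) t' U μ 0 *ᵥ ψ (Ls j) =
      (((dWaveSourceTorusTT' (Ls j) t' U μ 0).groundEnergy : ℝ) : ℂ) • ψ (Ls j))
    {ε : ℝ} (hε : 0 < ε) :
    ∀ᶠ j in atTop, torusDiagonal dWaveFormFactor (Ls j) (ψ (Ls j)) ≤ dWaveOrderParameterTT' t' U μ ^ 2 + ε := by
  have h := eventually_torusDiagonal_le_of_groundStates hLs le_rfl hunit hgs hε
  have hsq : (derivWithin (dWaveSourceEnergyDensityTT' t' U μ) (Ioi 0) 0 / 2) ^ 2 =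
      dWaveOrderParameterTT' t' U μ ^ 2 := by
    rw [dWaveOrderParameterTT'_eq_neg_half_rightDeriv]; ring
  simpa only [hsq] using h

/-- **PAIR LRO ⇒ RESPONSE on the torus, every `t'`** (Koma–Tasaki's contrapositive reading): if along the
ground-state sequence the torus pair LRO is frequently at least `s`, then `√s ≤ m⋆(t',U,μ)`.
[cite: KomaTasaki1993, Theorem 7.3] -/
theorem sqrt_le_dWaveOrderParameterTT'_of_frequently_le (hLs : Tendsto Ls atTop atTop)
    (hunit : ∀ j, star (ψ (Ls j)) ⬝ᵥ ψ (Ls j) = 1)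
    (hgs : ∀ j, dWaveSourceTorusTT' (Ls j) t' U μ 0 *ᵥ ψ (Ls j) =
      (((dWaveSourceTorusTT' (Ls j) t' U μ 0).groundEnergy : ℝ) : ℂ) • ψ (Ls j))
    {s : ℝ} (hs : ∃ᶠ j in atTop, s ≤ torusDiagonal dWaveFormFactor (Ls j) (ψ (Ls j))) :
    Real.sqrt s ≤ dWaveOrderParameterTT' t' U μ := by
  have hm0 := dWaveOrderParameterTT'_nonneg t' U μ
  have hle : s ≤ dWaveOrderParameterTT' t' U μ ^ 2 := by
    refine le_of_forall_pos_le_add fun ε hε => ?_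
    obtain ⟨j, hj1, hj2⟩ :=
      (hs.and_eventually (eventually_torusDiagonal_le_sq_dWaveOrderParameterTT'_add hLs hunit hgs hε)).exists
    exact hj1.trans hj2
  calc Real.sqrt s ≤ Real.sqrt (dWaveOrderParameterTT' t' U μ ^ 2) := Real.sqrt_le_sqrt hle
    _ = dWaveOrderParameterTT' t' U μ := Real.sqrt_sq hm0

/-- **Any positive asymptotic torus pair LRO in grand-canonical ground states forces quasi-average `d`-wave
order** (`HasDWaveOrderTT' t' U μ`), at every `t'`. [cite: KomaTasaki1993, Theorem 7.3] -/
theorem hasDWaveOrderTT'_of_frequently_le (hLs : Tendsto Ls atTop atTop)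
    (hunit : ∀ j, star (ψ (Ls j)) ⬝ᵥ ψ (Ls j) = 1)
    (hgs : ∀ j, dWaveSourceTorusTT' (Ls j) t' U μ 0 *ᵥ ψ (Ls j) =
      (((dWaveSourceTorusTT' (Ls j) t' U μ 0).groundEnergy : ℝ) : ℂ) • ψ (Ls j))
    {s : ℝ} (hs0 : 0 < s) (hs : ∃ᶠ j in atTop, s ≤ torusDiagonal dWaveFormFactor (Ls j) (ψ (Ls j))) :
    HasDWaveOrderTT' t' U μ := by
  have h := sqrt_le_dWaveOrderParameterTT'_of_frequently_le hLs hunit hgs hs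
  have hpos : 0 < Real.sqrt s := Real.sqrt_pos.2 hs0
  exact lt_of_lt_of_le hpos h

end GrandCanonical

/-! ### The summit's class: canonical sector ground states of the `t–t'` Hubbard tori -/

section Sector

variable [∀ j, NeZero (Ls j)] {t' U n : ℝ}

/-- **KT93 Thm 7.3 for the summit's SECTOR ground states, every `t'`**: for unit ground states `ψ_{L_j}` of
`hubbardTorusTT' (Ls j) 1 t' U` in the sectors `(rectN n (Ls j), S^z = 0)` (`U ≥ 0`, `0 < n < 2`, `L_j → ∞`):
if `(dWaveOrderParameterTT' t' U μ)² ≤ c` at EVERY chemical potential `μ` supporting a translation-invariant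
ground state of density `n`, then `∀ ε > 0`, eventually `L⁻⁴ Re⟨ψ, Δ_d†Δ_d ψ⟩ ≤ c + ε`. (Every torus limit is a
translation-invariant ground state of the `μ`-pencil for a supporting `μ`, of density `n`:
`IsTorusLimitOf.symmetric_groundState_of_sectorGroundStates`.) [cite: KomaTasaki1993, Theorem 7.3] -/
theorem eventually_torusDiagonal_le_of_sectorGroundStates (hU : 0 ≤ U) (hn0 : 0 < n) (hn2 : n < 2)
    (hLs : Tendsto Ls atTop atTop)
    (hψ : ∀ j, IsGroundStateInSector (hubbardTorusTT' (Ls j) 1 t' U) (rectN n (Ls j)) 0 (ψ (Ls j)))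
    (hunit : ∀ j, star (ψ (Ls j)) ⬝ᵥ ψ (Ls j) = 1) {c : ℝ}
    (hc : ∀ (μ : ℝ) (ω : InfVolFermionState 2), ω.IsMeanEnergyMinimiser (hubbardTTPrimeMuInteraction 1 t' U μ) 1 →
      ω.density = n → dWaveOrderParameterTT' t' U μ ^ 2 ≤ c)
    {ε : ℝ} (hε : 0 < ε) :
    ∀ᶠ j in atTop, torusDiagonal dWaveFormFactor (Ls j) (ψ (Ls j)) ≤ c + ε := by
  refine eventually_torusDiagonal_le_of_torusLimitCeiling dWaveFormFactor hLs hunit ?_ hε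
  intro φ hφ ω hω δ hδ
  haveI : ∀ k, NeZero ((Ls ∘ φ) k) := fun k => inferInstanceAs (NeZero (Ls (φ k)))
  have hLs' : Tendsto (Ls ∘ φ) atTop atTop := hLs.comp hφ.tendsto_atTop
  obtain ⟨-, -, hρ, -, μ, hμ⟩ := hω.symmetric_groundState_of_sectorGroundStates t' hU hn0 hn2 hLs'
    (fun j => hψ (φ j)) (fun j => hunit (φ j))
  have hcμ := hc μ ω hμ hρ
  have hceil := zeroFieldPairLROCeiling_holds t' U μ hμ δ hδ
  filter_upwards [hceil] with N hN
  exact hN.trans (by linarith)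

/-- **No quasi-average `d`-wave order at any supporting chemical potential ⇒ the torus pair LRO of the
summit's sector ground states tends to zero** (every `t'`; `U ≥ 0`, `0 < n < 2`).
[cite: KomaTasaki1993, Theorem 7.3] -/
theorem tendsto_torusDiagonal_zero_of_sectorGroundStates (hU : 0 ≤ U) (hn0 : 0 < n) (hn2 : n < 2)
    (hLs : Tendsto Ls atTop atTop)
    (hψ : ∀ j, IsGroundStateInSector (hubbardTorusTT' (Ls j) 1 t' U) (rectN n (Ls j)) 0 (ψ (Ls j)))
    (hunit : ∀ j, star (ψ (Ls j)) ⬝ᵥ ψ (Ls j) = 1)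
    (hno : ∀ (μ : ℝ) (ω : InfVolFermionState 2), ω.IsMeanEnergyMinimiser (hubbardTTPrimeMuInteraction 1 t' U μ) 1 →
      ω.density = n → ¬ HasDWaveOrderTT' t' U μ) :
    Tendsto (fun j => torusDiagonal dWaveFormFactor (Ls j) (ψ (Ls j))) atTop (𝓝 0) := by
  have hc : ∀ (μ : ℝ) (ω : InfVolFermionState 2), ω.IsMeanEnergyMinimiser (hubbardTTPrimeMuInteraction 1 t' U μ) 1 →
      ω.density = n → dWaveOrderParameterTT' t' U μ ^ 2 ≤ 0 := by
    intro μ ω hω hρ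
    have h0 : dWaveOrderParameterTT' t' U μ = 0 :=
      le_antisymm (not_lt.1 (hno μ ω hω hρ)) (dWaveOrderParameterTT'_nonneg t' U μ)
    rw [h0]; norm_num
  rw [Metric.tendsto_atTop]
  intro ε hε
  have hev := eventually_torusDiagonal_le_of_sectorGroundStates hU hn0 hn2 hLs hψ hunit hc (half_pos hε)
  obtain ⟨J, hJ⟩ := eventually_atTop.1 hev
  refine ⟨J, fun j hj => ?_⟩
  have h0 := torusDiagonal_nonneg dWaveFormFactor (Ls j) (ψ (Ls j))
  rw [Real.dist_eq, abs_lt]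
  constructor <;> linarith [hJ j hj]

end Sector

/-! ### The finite-`h` band and clustering on the torus (ceiling above ∧ the Literature floor) -/

section Band

variable [∀ j, NeZero (Ls j)] {t' U μ h : ℝ}

/-- **THE FINITE-`h` BAND ON THE TORUS**: along unit ground-state vectors `ψ_{L_j}` of the pair-sourced tori
`A_{L_j}(t',U,μ,h)` at a field `h > 0`, for every `ε > 0` eventually
`(∂⁻E(h)/2)² − ε ≤ L⁻⁴ Re⟨ψ, Δ_d†Δ_d ψ⟩ ≤ (∂⁺E(h)/2)² + ε` — the torus twin of the infinite-volume band
(F) ∧ (C) of the transplant dictionary (floor: hubbard-cq-p4 `eventually_sq_half_leftDeriv_sub_le_torusDiagonal`,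
Griffiths for ground-state vectors; ceiling: `eventually_torusDiagonal_le_of_groundStates`).
[cite: Griffiths1966, §II] [cite: KomaTasaki1993, Theorem 7.3] -/
theorem eventually_torusDiagonal_mem_Icc_of_groundStates (hLs : Tendsto Ls atTop atTop) (hh : 0 < h)
    (hunit : ∀ j, star (ψ (Ls j)) ⬝ᵥ ψ (Ls j) = 1)
    (hgs : ∀ j, dWaveSourceTorusTT' (Ls j) t' U μ h *ᵥ ψ (Ls j) =
      (((dWaveSourceTorusTT' (Ls j) t' U μ h).groundEnergy : ℝ) : ℂ) • ψ (Ls j))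
    {ε : ℝ} (hε : 0 < ε) :
    ∀ᶠ j in atTop, torusDiagonal dWaveFormFactor (Ls j) (ψ (Ls j)) ∈
      Set.Icc ((derivWithin (dWaveSourceEnergyDensityTT' t' U μ) (Iio h) h / 2) ^ 2 - ε)
        ((derivWithin (dWaveSourceEnergyDensityTT' t' U μ) (Ioi h) h / 2) ^ 2 + ε) := by
  filter_upwards [eventually_sq_half_leftDeriv_sub_le_torusDiagonal hLs hh hunit hgs hε,
    eventually_torusDiagonal_le_of_groundStates hLs hh.le hunit hgs hε] with j h1 h2
  exact ⟨h1, h2⟩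

/-- **CLUSTERING ON THE TORUS off the kinks** (BN-T5, torus form): at a field `h > 0` where
`E = dWaveSourceEnergyDensityTT' t' U μ` is differentiable with `E'(h) = e'`, the torus pair long-range order of
EVERY sequence of unit ground-state vectors of `A_{L_j}(t',U,μ,h)` converges to the response squared:
`L⁻⁴ Re⟨ψ_{L_j}, Δ_d†Δ_d ψ_{L_j}⟩ → (e'/2)²` — the finite-`h` torus LRO word IS the response word squared, no
independent bit. [cite: Griffiths1966, §II] [cite: KomaTasaki1993, Theorem 7.3] -/
theorem tendsto_torusDiagonal_of_groundStates_of_hasDerivAt (hLs : Tendsto Ls atTop atTop) (hh : 0 < h)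
    (hunit : ∀ j, star (ψ (Ls j)) ⬝ᵥ ψ (Ls j) = 1)
    (hgs : ∀ j, dWaveSourceTorusTT' (Ls j) t' U μ h *ᵥ ψ (Ls j) =
      (((dWaveSourceTorusTT' (Ls j) t' U μ h).groundEnergy : ℝ) : ℂ) • ψ (Ls j))
    {e' : ℝ} (hd : HasDerivAt (dWaveSourceEnergyDensityTT' t' U μ) e' h) :
    Tendsto (fun j => torusDiagonal dWaveFormFactor (Ls j) (ψ (Ls j))) atTop (𝓝 ((e' / 2) ^ 2)) := by
  have hR : derivWithin (dWaveSourceEnergyDensityTT' t' U μ) (Ioi h) h = e' :=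
    hd.hasDerivWithinAt.derivWithin (uniqueDiffWithinAt_Ioi h)
  have hL' : derivWithin (dWaveSourceEnergyDensityTT' t' U μ) (Iio h) h = e' :=
    hd.hasDerivWithinAt.derivWithin (uniqueDiffWithinAt_Iio h)
  rw [Metric.tendsto_atTop]
  intro ε hε
  have hev := eventually_torusDiagonal_mem_Icc_of_groundStates hLs hh hunit hgs (half_pos hε)
  rw [hR, hL'] at hev
  obtain ⟨J, hJ⟩ := eventually_atTop.1 hev
  refine ⟨J, fun j hj => ?_⟩
  obtain ⟨hlo, hhi⟩ := hJ j hj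
  rw [Real.dist_eq, abs_lt]
  constructor <;> linarith

/-- The same with the pair amplitude: off the kinks BOTH `2 Re⟨ψ_{L_j}, Δ_dψ_{L_j}⟩/L_j² → −e'` (hubbard-cq-p4's
vector Griffiths theorem) and `s_{L_j} → (e'/2)²`, so `s_{L_j} − (Re⟨ψ,Δ_dψ⟩/L²)² → 0`: asymptotically the torus
pair LRO of a sourced ground state is EXHAUSTED by its one-point amplitude. [cite: Griffiths1966, §II] -/
theorem tendsto_torusDiagonal_sub_sq_re_expect_div_of_hasDerivAt (hLs : Tendsto Ls atTop atTop) (hh : 0 < h)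
    (hunit : ∀ j, star (ψ (Ls j)) ⬝ᵥ ψ (Ls j) = 1)
    (hgs : ∀ j, dWaveSourceTorusTT' (Ls j) t' U μ h *ᵥ ψ (Ls j) =
      (((dWaveSourceTorusTT' (Ls j) t' U μ h).groundEnergy : ℝ) : ℂ) • ψ (Ls j))
    {e' : ℝ} (hd : HasDerivAt (dWaveSourceEnergyDensityTT' t' U μ) e' h) :
    Tendsto (fun j => torusDiagonal dWaveFormFactor (Ls j) (ψ (Ls j)) -
      ((expect (pairField dWaveFormFactor (Ls j)) (ψ (Ls j))).re / ((Ls j : ℝ)) ^ 2) ^ 2) atTop (𝓝 0) := by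
  have h1 := tendsto_torusDiagonal_of_groundStates_of_hasDerivAt hLs hh hunit hgs hd
  have h2 := tendsto_two_mul_re_expect_pairField_div_of_hasDerivAt hLs hunit hgs hd
  have h3 : Tendsto (fun j => ((expect (pairField dWaveFormFactor (Ls j)) (ψ (Ls j))).re / ((Ls j : ℝ)) ^ 2) ^ 2)
      atTop (𝓝 ((e' / 2) ^ 2)) := by
    have h4 : Tendsto (fun j => (2 * (expect (pairField dWaveFormFactor (Ls j)) (ψ (Ls j))).re /
        ((Ls j : ℝ)) ^ 2) / 2) atTop (𝓝 (-e' / 2)) := h2.div_const 2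
    have h5 := h4.pow 2
    have e1 : (-e' / 2) ^ 2 = (e' / 2) ^ 2 := by ring
    rw [e1] at h5
    refine h5.congr fun j => ?_
    ring
  have := h1.sub h3
  rwa [sub_self] at this

end Band

/-! ### Modulo `[U] ∧ [BN7]`: the torus pair LRO CONVERGES to `(m⋆)²` (the sharp torus identity) -/

section Sharp

variable [∀ j, NeZero (Ls j)] {ω : InfVolFermionState 2} {t' U μ : ℝ}

/-- **THE SHARP KOMA–TASAKI IDENTITY ON THE TORUS, modulo the two physics inputs of census (44)/(47)**: if the
gauge-symmetric translation-invariant ground state of the `t–t'` pencil is unique (`[U]`) and the small-momentum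
window of the pair structure factor is tight along the sequence (`[BN7]`, hubbard-cq-p6's form), then along every
torus-limit sequence of unit, fixed-particle-number grand-canonical ground-state vectors of `hubbardTorusTT' − μN`
the torus pair LRO CONVERGES to `(m⋆)²`: `s_{L_j}(ψ_{L_j}) → (dWaveOrderParameterTT' t' U μ)²` — p6's floor (F5)
`sq_dWaveOrderParameterTT'_le_liminf_torusDiagonal_of_unique_symmetric` below, the unconditional ceiling
`eventually_torusDiagonal_le_sq_dWaveOrderParameterTT'_add` above. [cite: KomaTasaki1993, Theorem 7.3]
[cite: KomaTasaki1994, §1] -/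
theorem tendsto_torusDiagonal_sq_dWaveOrderParameterTT'_of_unique_symmetric_of_tight
    (hU : ∀ ω₁ ω₂ : InfVolFermionState 2,
      ω₁.IsMeanEnergyMinimiser (hubbardTTPrimeMuInteraction 1 t' U μ) 1 → ω₁.IsGaugeInvariant →
      ω₂.IsMeanEnergyMinimiser (hubbardTTPrimeMuInteraction 1 t' U μ) 1 → ω₂.IsGaugeInvariant → ω₁ = ω₂)
    (hω : ω.IsTorusLimitOf ψ Ls) (hLs : Tendsto Ls atTop atTop)
    (hunit : ∀ j, star (ψ (Ls j)) ⬝ᵥ ψ (Ls j) = 1) {N : ℕ → ℕ} (hN : ∀ j, IsNParticle (N j) (ψ (Ls j)))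
    (hgs : ∀ j, dWaveSourceTorusTT' (Ls j) t' U μ 0 *ᵥ ψ (Ls j) =
      (((dWaveSourceTorusTT' (Ls j) t' U μ 0).groundEnergy : ℝ) : ℂ) • ψ (Ls j))
    {τ : ℝ → ℝ} (hτ : ∀ ε : ℝ, 0 < ε → ∀ᶠ j in atTop, windowTail dWaveFormFactor (Ls j) (ψ (Ls j)) ε ≤ τ ε)
    (hτ0 : Tendsto τ (𝓝[>] 0) (𝓝 0)) :
    Tendsto (fun j => torusDiagonal dWaveFormFactor (Ls j) (ψ (Ls j))) atTop
      (𝓝 (dWaveOrderParameterTT' t' U μ ^ 2)) := by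
  have hlo := hω.sq_dWaveOrderParameterTT'_le_liminf_torusDiagonal_of_unique_symmetric t' U μ hU hLs hunit hN
    hgs hτ hτ0
  have hbdd : IsBoundedUnder (· ≥ ·) atTop (fun j => torusDiagonal dWaveFormFactor (Ls j) (ψ (Ls j))) :=
    isBoundedUnder_of ⟨0, fun j => torusDiagonal_nonneg dWaveFormFactor (Ls j) (ψ (Ls j))⟩
  rw [tendsto_order]
  refine ⟨fun a ha => ?_, fun b hb => ?_⟩
  · exact eventually_lt_of_lt_liminf (lt_of_lt_of_le ha hlo) hbdd
  · have hε : 0 < (b - dWaveOrderParameterTT' t' U μ ^ 2) / 2 := by linarith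
    filter_upwards [eventually_torusDiagonal_le_sq_dWaveOrderParameterTT'_add hLs hunit hgs hε] with j hj
    linarith

/-- The same stated without a torus-limit hypothesis: EVERY sequence of unit, fixed-`N` ground-state vectors of
`hubbardTorusTT' − μN` along `L_j → ∞` has a SUBSEQUENCE along which — given `[U]` and window tightness of the
sequence — the torus pair LRO converges to `(m⋆)²` (weak-⋆ compactness supplies the torus limit).
[cite: KomaTasaki1993, Theorem 7.3] -/
theorem exists_subseq_tendsto_torusDiagonal_sq_dWaveOrderParameterTT'_of_unique_symmetric_of_tight
    (hU : ∀ ω₁ ω₂ : InfVolFermionState 2,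
      ω₁.IsMeanEnergyMinimiser (hubbardTTPrimeMuInteraction 1 t' U μ) 1 → ω₁.IsGaugeInvariant →
      ω₂.IsMeanEnergyMinimiser (hubbardTTPrimeMuInteraction 1 t' U μ) 1 → ω₂.IsGaugeInvariant → ω₁ = ω₂)
    (hLs : Tendsto Ls atTop atTop)
    (hunit : ∀ j, star (ψ (Ls j)) ⬝ᵥ ψ (Ls j) = 1) {N : ℕ → ℕ} (hN : ∀ j, IsNParticle (N j) (ψ (Ls j)))
    (hgs : ∀ j, dWaveSourceTorusTT' (Ls j) t' U μ 0 *ᵥ ψ (Ls j) =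
      (((dWaveSourceTorusTT' (Ls j) t' U μ 0).groundEnergy : ℝ) : ℂ) • ψ (Ls j))
    {τ : ℝ → ℝ} (hτ : ∀ ε : ℝ, 0 < ε → ∀ᶠ j in atTop, windowTail dWaveFormFactor (Ls j) (ψ (Ls j)) ε ≤ τ ε)
    (hτ0 : Tendsto τ (𝓝[>] 0) (𝓝 0)) :
    ∃ φ : ℕ → ℕ, StrictMono φ ∧
      Tendsto (fun j => torusDiagonal dWaveFormFactor (Ls (φ j)) (ψ (Ls (φ j)))) atTop
        (𝓝 (dWaveOrderParameterTT' t' U μ ^ 2)) := by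
  obtain ⟨φ, hφ, ω, hω⟩ := InfVolFermionState.exists_isTorusLimitOf_subseq ψ hLs hunit
  haveI : ∀ k, NeZero ((Ls ∘ φ) k) := fun k => inferInstanceAs (NeZero (Ls (φ k)))
  have hLs' : Tendsto (Ls ∘ φ) atTop atTop := hLs.comp hφ.tendsto_atTop
  refine ⟨φ, hφ, ?_⟩
  exact tendsto_torusDiagonal_sq_dWaveOrderParameterTT'_of_unique_symmetric_of_tight hU hω hLs'
    (fun j => hunit (φ j)) (fun j => hN (φ j)) (fun j => hgs (φ j))
    (fun ε hε => hφ.tendsto_atTop.eventually (hτ ε hε)) hτ0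

end Sharp

end Summit.Ventures.CertifiedManyBodySolver.Observables.TorusPairLROCeiling

end
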